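import Summits.ResolutionOfSingularities.ResolutionOfSingularities.Theorems.FrobeniusClosingSteerShannonCoarseningLemmas
import Mathlib.RingTheory.DiscreteValuationRing.TFAE

/-!
# Steer core, stub S0 `CompositeRankSS`, ν₁ input — part 2/2: every proper coarsening of a STRONGLY SWITCHING valuation ring is DISCRETE of rank one

OURS (campaign res-hironaka, rung L, slot W4.1, crux `Steer` stmt-ResolutionOfSingularities-16345, line
`switching_dichotomy` / res-L0-w41-strat-1's `ss-monomial-cycles` §F, registered frontier stub S0 `CompositeRankSS`; prover
seat res-type-028 gen 8 (the ν₁ input ⟨H1D-DISCRETE⟩ of the (b)-bridge `concl_of_discreteCoarsening_of_luZeroDimBelow`,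
`Theorems/FrobeniusClosingSteerCompositeRankLUBelow.lean`); replaces the role of no printed item; NOT a statement of the
manuscript under review; AI-produced, weaker than expert review). `--supports stmt-ResolutionOfSingularities-16345 --as helper`.
Theses-free, definition-free.

THE THEOREM `discrete_of_stronglySwitching`: for the torsor datum of `Steer` (`k` of characteristic `p`, `A₀ ⊆ O` regular at
the centre of the valuation ring `O` of `K`, `t ^ p ∈ A₀`, `Frac A₀[t] = K`) whose quadratic sequence along `O` EXHAUSTS
`O ∩ Frac A₀` (the line's `StronglySwitching O A₀`, spelled out), EVERY proper coarsening `O < O₁ < K` of `O` is discrete of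
rank one: `∃ π ≠ 0, v_{O₁} π < 1 ∧ ∀ z ≠ 0, ∃ m : ℤ, v_{O₁} z = v_{O₁} π ^ m` (the line's `Discrete O₁`, spelled out).

Route — Heinzer–Loper–Olberding–Schoutens–Toeniskoetter, *Ideal theory of infinite directed unions of local quadratic transforms*
(arXiv:1505.06445), Lemma 3.2 and Proposition 3.3 («a Shannon extension has an isolated singularity»: for a nonzero
NON-MAXIMAL prime `P` of `S = ⋃ R_i`, `S_P = (R_i)_{P ∩ R_i}` for `i ≫ 0`, a regular Noetherian local ring), read for the
Shannon extension `S = O ∩ Frac A₀` and the prime `𝔪_{O₁} ∩ S`: a non-unit `u` of `O` which is a unit of `O₁` and a fraction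
of `A₀` (a `p`-th power) lies in some member `R_n`; from there on the local ring `D = (R_m)_{𝔪_{O₁} ∩ R_m}` is constant
(part 1/2, HOT Lemma 3.2) and, by strong switching, CONTAINS `O₁ ∩ Frac A₀`; so `D` is a Noetherian valuation ring which is
not a field, i.e. a DVR (Mathlib `IsDiscreteValuationRing.TFAE`), and the value of its uniformizer generates the values of
`(Frac A₀)^×`, hence of `K^×` (part 1/2 §1: `p`-th powers land in `Frac A₀`).

CONSEQUENCE for the skeleton (holder's one-liner, nothing registered here): with the (b)-bridge, S0 `CompositeRankSS` closes
from the single named input «LUZeroDimBelow n» (zero-dimensional local uniformization below the transcendence degree) —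
the honest inductive knot of the R1 side; in particular a strongly switching valuation ring with a proper coarsening has
rank exactly `2` (a DVR has no proper overring but the field), as in loc. cit. Thm. 8.1.
-/

noncomputable section

-- single-problem summit: the doubled namespace component `ResolutionOfSingularities` is forced
set_option linter.dupNamespace false

open scoped BigOperators Classical

namespace Summit.ResolutionOfSingularities.ResolutionOfSingularities.Theorems.SwitchingDichotomy.Shannon

open IsLocalRing
open Literature.AlgebraicGeometry.Resolution

variable {k K : Type} [Field k] [Field K] [Algebra k K]

/-! ## §4 HOT Proposition 3.3 for the Shannon extension `O ∩ Frac A₀`: proper coarsenings are discrete -/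

/-- **Every proper coarsening of a strongly switching valuation ring is DISCRETE of rank one** (the ν₁ input
⟨H1D-DISCRETE⟩ of S0's (b)-bridge). Data: `k` of characteristic `p`, `A₀ ⊆ O` regular at the centre of the valuation ring
`O` of `K`, `t ^ p ∈ A₀`, `Frac A₀[t] = K`, and the quadratic sequence of `A₀` along `O` exhausts `O ∩ Frac A₀` (the line's
`StronglySwitching O A₀`, spelled out); `O < O₁ < K`. Conclusion: the line's `Discrete O₁`, spelled out. Proof: a non-unit
`u` of `O` which is a unit of `O₁` and a fraction of `A₀` (a `p`-th power, §2) lies in some member `R_n`; from there on the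
local ring `D = (R_m)_{𝔪_{O₁} ∩ R_m}` is constant (§3, HOT Lemma 3.2) and, by strong switching, contains `O₁ ∩ Frac A₀`;
so `D` is a Noetherian valuation ring which is not a field, a DVR (Mathlib `IsDiscreteValuationRing.TFAE`), and the
value of its uniformizer generates the values of `(Frac A₀)^×`, hence of `K^×` (§1). [cite: HeinzerEtAl2015, Proposition 3.3]
[cite: HeinzerEtAl2015, Lemma 3.2] -/
theorem discrete_of_stronglySwitching (p : ℕ) (hp : p.Prime) [CharP k p]
    (O O₁ : ValuationSubring K) (hO : O ≤ O₁) (hne : O ≠ O₁) (hO₁ : O₁ ≠ ⊤)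
    (A₀ : Subalgebra k K) (h₀ : A₀.toSubring ≤ O.toSubring) (t : K) (htp : t ^ p ∈ A₀)
    (hfr : IsFractionRing (Algebra.adjoin k (insert t (A₀ : Set K))) K)
    (hreg : IsRegularLocalRing (Localization.AtPrime
      (Ideal.comap (Subring.inclusion h₀) (maximalIdeal O))))
    (hSS : ∀ R : ℕ → Subring K, R 0 = locAtCentre A₀.toSubring O →
      (∀ i, IsQuadraticTransformAlong O (R i) (R (i + 1))) →
      ∀ x : K, x ∈ O → (∃ y ∈ A₀, ∃ z ∈ A₀, z ≠ 0 ∧ x = y / z) → ∃ i, x ∈ R i) :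
    ∃ π : K, π ≠ 0 ∧ O₁.valuation π < 1 ∧
      ∀ z : K, z ≠ 0 → ∃ m : ℤ, O₁.valuation z = O₁.valuation π ^ m := by
  classical
  haveI : Fact p.Prime := ⟨hp⟩
  haveI : CharP K p := charP_of_injective_algebraMap (algebraMap k K).injective p
  have hOO₁ : O.toSubring ≤ O₁.toSubring := fun z hz => hO hz
  -- units of `O₁` among the elements of `O₁` whose inverse lies in `O`
  have unit₁ : ∀ z : K, z ≠ 0 → z ∈ O₁ → z⁻¹ ∈ O → O₁.valuation z⁻¹ = 1 := by
    intro z hz0 hzO₁ hziO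
    apply le_antisymm ((O₁.valuation_le_one_iff _).mpr (hO hziO))
    have h := (O₁.valuation_le_one_iff z).mpr hzO₁
    rw [← inv_inv z, map_inv₀, inv_le_one₀ ((Valuation.pos_iff _).mpr (inv_ne_zero hz0))] at h
    exact h
  -- non-members have inverses of value `< 1`
  have nonunit : ∀ (O' : ValuationSubring K) (z : K), z ∉ O' → O'.valuation z⁻¹ < 1 := by
    intro O' z hz
    have hz0 : z ≠ 0 := fun h => hz (h ▸ O'.zero_mem)
    have hziO : z⁻¹ ∈ O' := (O'.mem_or_inv_mem z).resolve_left hz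
    rcases ((O'.valuation_le_one_iff _).mpr hziO).lt_or_eq with hlt | heq
    · exact hlt
    · exfalso
      apply hz
      have : (z⁻¹)⁻¹ ∈ O' := by rw [← O'.valuation_le_one_iff, map_inv₀, heq, inv_one]
      rwa [inv_inv] at this
  -- §2: `p`-th powers are fractions of `A₀`
  have hfrac : ∀ z : K, ∃ y ∈ A₀, ∃ w ∈ A₀, w ≠ 0 ∧ z ^ p = y / w := exists_pow_eq_div p A₀ t htp hfr
  -- the non-unit `u` of `O` which is a unit of `O₁`
  obtain ⟨w₀, hw₀O₁, hw₀O⟩ : ∃ w, w ∈ O₁ ∧ w ∉ O := by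
    by_contra h
    push Not at h
    exact hne (le_antisymm hO fun z hz => h z hz)
  have hw₀0 : w₀ ≠ 0 := fun h => hw₀O (h ▸ O.zero_mem)
  have hwiO : w₀⁻¹ ∈ O := (O.mem_or_inv_mem w₀).resolve_left hw₀O
  have hwiv : O.valuation w₀⁻¹ < 1 := nonunit O w₀ hw₀O
  have hwiv₁ : O₁.valuation w₀⁻¹ = 1 := unit₁ w₀ hw₀0 hw₀O₁ hwiO
  set u : K := (w₀⁻¹) ^ p with hudef
  have hu0 : u ≠ 0 := pow_ne_zero _ (inv_ne_zero hw₀0)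
  have huO : u ∈ O := pow_mem hwiO p
  have huv : O.valuation u < 1 := by
    rw [hudef, map_pow]; exact pow_lt_one₀ zero_le hwiv hp.ne_zero
  have huv₁ : O₁.valuation u = 1 := by rw [hudef, map_pow, hwiv₁, one_pow]
  have hufrac : ∃ y ∈ A₀, ∃ z ∈ A₀, z ≠ 0 ∧ u = y / z := hfrac (w₀⁻¹)
  -- a nonzero element of `A₀` of positive value, so that the quadratic sequence is infinite
  have ha : ∃ a ∈ A₀, a ≠ 0 ∧ O.valuation a < 1 := by
    obtain ⟨y, hy, z, hz, hz0, hyz⟩ := hufrac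
    refine ⟨y, hy, ?_, ?_⟩
    · rintro rfl
      rw [zero_div] at hyz
      exact hu0 hyz
    · have hzv : O.valuation z ≤ 1 := (O.valuation_le_one_iff _).mpr (h₀ hz)
      have hy' : O.valuation y = O.valuation u * O.valuation z := by
        rw [hyz, map_div₀, div_mul_cancel₀ _ ((map_ne_zero _).mpr hz0)]
      rw [hy']
      calc O.valuation u * O.valuation z ≤ O.valuation u * 1 := by gcongr
        _ < 1 := by rw [mul_one]; exact huv
  -- the quadratic sequence of the base along `O` (regular members, dominated, fractions of `A₀`)
  obtain ⟨R, hR0, hstep, hregR, hdomR, hfracR⟩ := stub_switchingSetup k K O A₀ h₀ hreg ha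
  have hSS' := hSS R hR0 hstep
  have hmono : Monotone R := sequence_monotone hstep
  have hRO : ∀ i, R i ≤ O.toSubring := fun i => (hdomR i).1
  have hRO₁ : ∀ i, R i ≤ O₁.toSubring := fun i => (hRO i).trans hOO₁
  -- the witness index `n`: `u ∈ R n`
  obtain ⟨n, hun⟩ := hSS' u huO hufrac
  -- HOT Lemma 3.2 iterated: the local ring at the centre of `O₁` is constant from `n` on
  have hconst : ∀ m, n ≤ m → locAtCentre (R m) O₁ = locAtCentre (R n) O₁ := by
    intro m hm
    induction m, hm using Nat.le_induction with
    | base => rfl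
    | succ m hm ih =>
      rw [← ih]
      exact locAtCentre_eq_of_isQuadraticTransformAlong hO (hstep m) (hmono hm hun) huv huv₁
  set D := locAtCentre (R n) O₁ with hDdef
  -- strong switching: `O₁ ∩ Frac A₀ ⊆ D` (HOT Proposition 3.3 for the prime `𝔪_{O₁} ∩ S`)
  have hD : ∀ z : K, z ∈ O₁ → (∃ y ∈ A₀, ∃ w ∈ A₀, w ≠ 0 ∧ z = y / w) → z ∈ D := by
    intro z hzO₁ hzf
    by_cases hzO : z ∈ O
    · obtain ⟨i, hi⟩ := hSS' z hzO hzf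
      have h1 : z ∈ R (max i n) := hmono (le_max_left i n) hi
      have h2 : z ∈ locAtCentre (R (max i n)) O₁ := le_locAtCentre _ O₁ h1
      rwa [hconst _ (le_max_right i n)] at h2
    · have hz0 : z ≠ 0 := fun h => hzO (h ▸ O.zero_mem)
      have hziO : z⁻¹ ∈ O := (O.mem_or_inv_mem z).resolve_left hzO
      have hzif : ∃ y ∈ A₀, ∃ w ∈ A₀, w ≠ 0 ∧ z⁻¹ = y / w := by
        obtain ⟨y, hy, w, hw, hw0, rfl⟩ := hzf
        have hy0 : y ≠ 0 := by
          rintro rfl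
          exact hz0 (zero_div w)
        exact ⟨w, hw, y, hy, hy0, by rw [inv_div]⟩
      obtain ⟨i, hi⟩ := hSS' z⁻¹ hziO hzif
      have h1 : z⁻¹ ∈ R (max i n) := hmono (le_max_left i n) hi
      have hv1 : O₁.valuation z⁻¹ = 1 := unit₁ z hz0 hzO₁ hziO
      have h2 : (z⁻¹)⁻¹ ∈ locAtCentre (R (max i n)) O₁ :=
        inv_mem_locAtCentre (le_locAtCentre _ O₁ h1) hv1
      rw [inv_inv, hconst _ (le_max_right i n)] at h2
      exact h2
  -- `D` is a Noetherian local domain inside `O₁`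
  have hRnO₁ : R n ≤ O₁.toSubring := hRO₁ n
  have hDO₁ : D ≤ O₁.toSubring := locAtCentre_le hRnO₁
  haveI hDloc : IsLocalRing D := isLocalRing_locAtCentre hRnO₁
  haveI : IsRegularLocalRing (R n) := hregR n
  haveI := isLocalization_locAtCentre hRnO₁
  haveI hDnoeth : IsNoetherianRing D :=
    IsLocalization.isNoetherianRing (subringCentre (R n) O₁ hRnO₁).primeCompl D inferInstance
  -- elements of `D` are fractions of `A₀`
  have hRnF : R n ≤ (Subfield.closure ((A₀.toSubring : Subring K) : Set K)).toSubring := by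
    intro x hx
    obtain ⟨y, hy, w, hw, -, rfl⟩ := hfracR n x hx
    exact (Subfield.closure ((A₀.toSubring : Subring K) : Set K)).div_mem
      (Subfield.subset_closure hy) (Subfield.subset_closure hw)
  have hDfrac : ∀ z : K, z ∈ D → ∃ y ∈ A₀, ∃ w ∈ A₀, w ≠ 0 ∧ z = y / w := by
    intro z hz
    have hzF : z ∈ Subfield.closure ((A₀.toSubring : Subring K) : Set K) :=
      locAtCentre_le_subfield O₁ hRnF hz
    obtain ⟨y, hy, w, hw, hw0, h⟩ := exists_div_eq_of_mem_subfieldClosure hzF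
    exact ⟨y, hy, w, hw, hw0, h⟩
  -- `D` is not a field: `s = (w₁⁻¹) ^ p` for `w₁ ∉ O₁` is a non-zero non-unit of `D`
  obtain ⟨w₁, hw₁⟩ : ∃ w, w ∉ O₁ := by
    by_contra h
    push Not at h
    apply hO₁
    ext z
    simp only [ValuationSubring.mem_top, iff_true]
    exact h z
  have hw₁0 : w₁ ≠ 0 := fun h => hw₁ (h ▸ O₁.zero_mem)
  have hw₁iO₁ : w₁⁻¹ ∈ O₁ := (O₁.mem_or_inv_mem w₁).resolve_left hw₁
  have hw₁iv : O₁.valuation w₁⁻¹ < 1 := nonunit O₁ w₁ hw₁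
  set s : K := (w₁⁻¹) ^ p with hsdef
  have hs0 : s ≠ 0 := pow_ne_zero _ (inv_ne_zero hw₁0)
  have hsO₁ : s ∈ O₁ := pow_mem hw₁iO₁ p
  have hsv : O₁.valuation s < 1 := by
    rw [hsdef, map_pow]; exact pow_lt_one₀ zero_le hw₁iv hp.ne_zero
  have hsD : s ∈ D := hD s hsO₁ (hfrac (w₁⁻¹))
  have hnf : ¬ IsField D := by
    intro hF
    have hsu : IsUnit (⟨s, hsD⟩ : D) := by
      obtain ⟨b, hb⟩ := hF.mul_inv_cancel
        (show (⟨s, hsD⟩ : D) ≠ 0 from fun h => hs0 (congrArg Subtype.val h))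
      exact IsUnit.of_mul_eq_one _ hb
    exact (not_isUnit_locAtCentre_iff hRnO₁ ⟨s, hsD⟩).mpr hsv hsu
  -- `D` is a valuation ring of `Frac A₀`
  have hpre : PreValuationRing D := by
    refine ⟨fun a b => ?_⟩
    by_cases ha0 : (a : K) = 0
    · refine ⟨0, Or.inr (Subtype.ext ?_)⟩
      change (b : K) * 0 = a
      rw [mul_zero, ha0]
    by_cases hb0 : (b : K) = 0
    · refine ⟨0, Or.inl (Subtype.ext ?_)⟩
      change (a : K) * 0 = b
      rw [mul_zero, hb0]
    -- `b / a` is a fraction of `A₀`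
    have hxf : ∃ y ∈ A₀, ∃ w ∈ A₀, w ≠ 0 ∧ (b : K) / a = y / w := by
      obtain ⟨y₁, hy₁, v₁, hv₁, hv₁0, ha'⟩ := hDfrac a a.2
      obtain ⟨y₂, hy₂, v₂, hv₂, hv₂0, hb'⟩ := hDfrac b b.2
      have hy₁0 : y₁ ≠ 0 := by
        rintro rfl
        rw [zero_div] at ha'
        exact ha0 ha'
      refine ⟨y₂ * v₁, A₀.mul_mem hy₂ hv₁, v₂ * y₁, A₀.mul_mem hv₂ hy₁, mul_ne_zero hv₂0 hy₁0, ?_⟩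
      rw [ha', hb']
      field_simp
    have hxif : ∃ y ∈ A₀, ∃ w ∈ A₀, w ≠ 0 ∧ ((b : K) / a)⁻¹ = y / w := by
      obtain ⟨y, hy, w, hw, hw0, h⟩ := hxf
      have hy0 : y ≠ 0 := by
        rintro rfl
        rw [zero_div] at h
        exact (div_ne_zero hb0 ha0) h
      exact ⟨w, hw, y, hy, hy0, by rw [h, inv_div]⟩
    rcases O₁.mem_or_inv_mem ((b : K) / a) with hx | hx
    · have hxD : (b : K) / a ∈ D := hD _ hx hxf
      refine ⟨⟨_, hxD⟩, Or.inl (Subtype.ext ?_)⟩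
      change (a : K) * ((b : K) / a) = b
      rw [mul_div_cancel₀ _ ha0]
    · have hxD : ((b : K) / a)⁻¹ ∈ D := hD _ hx hxif
      refine ⟨⟨_, hxD⟩, Or.inr (Subtype.ext ?_)⟩
      change (b : K) * ((b : K) / a)⁻¹ = a
      rw [inv_div, mul_div_cancel₀ _ hb0]
  -- hence a DVR
  have hval : ValuationRing D := by
    haveI := hpre
    exact ⟨⟩
  haveI hdvr : IsDiscreteValuationRing D := ((IsDiscreteValuationRing.TFAE D hnf).out 0 1).mpr hval
  obtain ⟨ϖ, hϖ⟩ := IsDiscreteValuationRing.exists_irreducible D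
  have hπ0 : (ϖ : K) ≠ 0 := fun h => hϖ.ne_zero (Subtype.ext h)
  have hπv : O₁.valuation (ϖ : K) < 1 := (not_isUnit_locAtCentre_iff hRnO₁ ϖ).mp hϖ.not_isUnit
  -- units of `D` have value `1`
  have hunitv : ∀ u' : Dˣ, O₁.valuation ((u' : D) : K) = 1 := by
    intro u'
    have h1 : ¬ O₁.valuation ((u' : D) : K) < 1 := fun h =>
      (not_isUnit_locAtCentre_iff hRnO₁ (u' : D)).mpr h u'.isUnit
    exact le_antisymm ((O₁.valuation_le_one_iff _).mpr (hDO₁ (u' : D).2)) (not_lt.mp h1)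
  -- `A₀ ⊆ D`
  have hA₀D : ∀ y ∈ A₀, y ∈ D := fun y hy => by
    have h1 : y ∈ R 0 := by rw [hR0]; exact le_locAtCentre _ O hy
    exact le_locAtCentre _ O₁ (hmono (Nat.zero_le n) h1)
  -- values of `p`-th powers are integer powers of `v ϖ`
  have hpow : ∀ (x : K) (hx : x ∈ A₀), x ≠ 0 → ∃ a : ℕ, O₁.valuation x = O₁.valuation (ϖ : K) ^ (a : ℤ) := by
    intro x hx hx0
    have hxD : (⟨x, hA₀D x hx⟩ : D) ≠ 0 := fun h => hx0 (congrArg Subtype.val h)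
    obtain ⟨a, ua, hxa⟩ := IsDiscreteValuationRing.eq_unit_mul_pow_irreducible hxD hϖ
    refine ⟨a, ?_⟩
    have h := congrArg (fun d : D => O₁.valuation (d : K)) hxa
    simp only [Subring.coe_mul, SubmonoidClass.coe_pow, map_mul, map_pow] at h
    rw [zpow_natCast, h, hunitv ua, one_mul]
  have H : ∀ z : K, z ≠ 0 → ∃ e : ℤ, O₁.valuation (z ^ p) = O₁.valuation (ϖ : K) ^ e := by
    intro z hz
    obtain ⟨y, hy, w, hw, hw0, hzp⟩ := hfrac z
    have hy0 : y ≠ 0 := by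
      rintro rfl
      rw [zero_div] at hzp
      exact pow_ne_zero p hz hzp
    obtain ⟨a, hya⟩ := hpow y hy hy0
    obtain ⟨b, hwb⟩ := hpow w hw hw0
    refine ⟨(a : ℤ) - b, ?_⟩
    rw [hzp, map_div₀, hya, hwb, zpow_sub₀ ((map_ne_zero _).mpr hπ0)]
  exact exists_discrete_of_pow O₁ hp.pos hπ0 hπv H

end Summit.ResolutionOfSingularities.ResolutionOfSingularities.Theorems.SwitchingDichotomy.Shannon
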